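import Literature.NumberTheory.LFunctions.MertensFirstChainCheck
import HarnessLib

/-!
# Rosser–Schoenfeld's (3.22) on `[319, 442439]` by kernel computation: certified run, chunk 2 of 2

Topic: `Literature/NumberTheory/LFunctions`. Pure proof file (a kernel computation; nothing is
asserted, no definition). Part of the discharge programme of
`Literature.NumberTheory.LFunctions.RosserSchoenfeld1962_eq_3_22` (Rosser–Schoenfeld 1962, Thm. 6
(3.22)). `run2` evaluates `MertensFirstChain.runDM 17128` on the state reached by chunk 1
(`MertensFirstChainRun1.lean`, the prime `224743`) and records the resulting state: the prime
`442439`, the first prime beyond `e¹³ = 442413.39…`, where the analytic argument takes over. The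
meaning of these states is supplied by `MertensFirstChain.runDM_sound` (`MertensFirstChainSound.lean`);
the assembly is `MertensFirstSmallRange.lean`. `decide +kernel`, standard axioms only
(`maxHeartbeats 0` for this one declaration).

## References

* J. B. Rosser, L. Schoenfeld, Illinois J. Math. 6 (1962), 64–94, Thm. 6 (3.22) and p. 87.
  [RosserSchoenfeld1962]
-/

namespace Literature.NumberTheory.LFunctions.MertensFirstChainRun

open MertensFirstChain

set_option maxHeartbeats 0 in
/-- **Chunk 2 of the certified Mertens run** (steps `20000` to `37128`, primes `224743` to `442439`).
[cite: RosserSchoenfeld1962, Thm. 6 (3.22)] -/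
theorem run2 :
    runDM 17128
      ⟨224743, 14897245679027811038026167, 14897245679028286644533155,
        13289279305559807331808632, 913176825354206810855071⟩ =
    some ⟨442439, 15716105628607899312644944, 15716105628608374919620644,
        14107133587455640452304100, 913179468369670269995473⟩ := by
  decide +kernel

end Literature.NumberTheory.LFunctions.MertensFirstChainRun
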